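import Mathlib
import Summits.ValiantsHypothesis.ValiantsHypothesis.Theorems.FifoMatchingNNLinearDegreeCofactorHardInflateTests
import Summits.ValiantsHypothesis.ValiantsHypothesis.Theorems.FifoMatchingNNLinearDegreeCofactorHardAdaptiveBlockTests
import HarnessLib

/-!
# Crux `NNLinearDegreeCofactorHard` (stmt-ValiantsHypothesis-23918) / rung S11 (stmt-ValiantsHypothesis-24468), line
# `internal_cofactor`: the TEST BRANCH priced — respecting words with many canonical tests are rare

Composition of `…InflateTests.lean` (canonical forbidden code sets `forbidden R L m σ j y` of the inflated word: a respecting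
word avoids them, `code_not_mem_forbidden`; they are past-measurable on middle pairs, `forbidden_eq_of_agree`) with the adaptive
block test lemma `AdaptiveBlockTests.card_adaptiveAvoid_le`:

* `card_resp_tests_le` — for any set `A` of bit strings whose inflated words have FIFO pairings respecting the colouring `σ`,
  if every `y ∈ A` meets at least `r` MIDDLE pairs (`2j+2 ≤ 2·jE`) whose canonical forbidden set has `≥ f` codes
  (`1 ≤ f ≤ 3`), then `#A · 4^r ≤ (4 − f)^r · 4^J` (`J = #Rᶜ/2`): the «≥ r₀ tests» branch of the (D‴) dichotomy costs
  `((4−f)/4)^{r₀}`, with NO assumption on where the tests sit.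

Honest framing: bookkeeping for the exponent-2 rung's composition (F‴); the other branch (gates) is the open heart (D‴);
nothing here proves S11, S2b, the crux or VP ≠ VNP.  No definitions, no named facts.
-/

noncomputable section

-- Sub = Summit single-conjunct layout: the duplicated namespace component is mandated by the tree.
set_option linter.dupNamespace false

namespace Summit.ValiantsHypothesis.ValiantsHypothesis.Theorems.FifoMatching.NNLinearDegreeCofactorHard.InflateWord

open Finset Literature.Computability.AlgebraicComplexity
open Summit.ValiantsHypothesis.ValiantsHypothesis.Theorems.FifoMatching.NNLinearDegreeCofactorHard.AdaptiveBlockTests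

variable {N : ℕ} (R : Finset (Fin N)) (L m : ℕ) (σ : Fin N → Bool)

/-- **The test branch.**  See the module docstring. [folklore] -/
theorem card_resp_tests_le (f r : ℕ) (hf1 : 1 ≤ f) (hf : f ≤ 3)
    (A : Finset (Fin (2 * (Rᶜ.card / 2)) → Bool))
    (hA : ∀ y ∈ A, ∃ hbal : (closerSet (inflateWord R L m y)).card = (openerSet (inflateWord R L m y)).card,
      ∀ k : Fin (openerSet (inflateWord R L m y)).card,
        σ ((openerSet (inflateWord R L m y)).orderEmbOfFin rfl k)
          = σ ((closerSet (inflateWord R L m y)).orderEmbOfFin hbal k))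
    (hr : ∀ y ∈ A, r ≤ ((range (Rᶜ.card / 2)).filter fun j =>
      2 * j + 2 ≤ 2 * tailPairs R L m ∧ f ≤ (forbidden R L m σ j y).card).card) :
    A.card * 4 ^ r ≤ (4 - f) ^ r * 4 ^ (Rᶜ.card / 2) := by
  classical
  -- the forbidden sets of the adaptive lemma: canonical on middle pairs, empty elsewhere
  set Φ : ℕ → (Fin (2 * (Rᶜ.card / 2)) → Bool) → Finset (Bool × Bool) :=
    fun j y => if 2 * j + 2 ≤ 2 * tailPairs R L m then forbidden R L m σ j y else ∅ with hΦ
  have hmeas : ∀ j (v w : Fin (2 * (Rᶜ.card / 2)) → Bool),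
      (∀ i : Fin (2 * (Rᶜ.card / 2)), i.val < 2 * j → v i = w i) → Φ j v = Φ j w := by
    intro j v w hvw
    simp only [hΦ]
    split_ifs with hj
    · exact forbidden_eq_of_agree R L m σ j hj hvw
    · rfl
  have havoid : ∀ y ∈ A, ∀ j < Rᶜ.card / 2,
      ((if h : 2 * j < 2 * (Rᶜ.card / 2) then y ⟨2 * j, h⟩ else false),
        (if h : 2 * j + 1 < 2 * (Rᶜ.card / 2) then y ⟨2 * j + 1, h⟩ else false)) ∉ Φ j y := by
    intro y hy j _
    obtain ⟨hbal, hresp⟩ := hA y hy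
    by_cases hj : 2 * j + 2 ≤ 2 * tailPairs R L m
    · have e : Φ j y = forbidden R L m σ j y := by simp only [hΦ]; rw [if_pos hj]
      rw [e]
      exact code_not_mem_forbidden R L m σ y hbal hresp j
    · have e : Φ j y = ∅ := by simp only [hΦ]; rw [if_neg hj]
      rw [e]
      exact notMem_empty _
  have htests : ∀ y ∈ A, r ≤ ((range (Rᶜ.card / 2)).filter fun j => f ≤ (Φ j y).card).card := by
    intro y hy
    refine (hr y hy).trans (le_of_eq ?_)
    congr 1
    refine filter_congr fun j _ => ?_
    by_cases hj : 2 * j + 2 ≤ 2 * tailPairs R L m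
    · have e : Φ j y = forbidden R L m σ j y := by simp only [hΦ]; rw [if_pos hj]
      rw [e]
      exact ⟨fun h => h.2, fun h => ⟨hj, h⟩⟩
    · have e : Φ j y = ∅ := by simp only [hΦ]; rw [if_neg hj]
      rw [e, card_empty]
      constructor
      · rintro ⟨h, -⟩; exact absurd h hj
      · intro h; omega
  exact card_adaptiveAvoid_le f r hf Φ hmeas A havoid htests

end Summit.ValiantsHypothesis.ValiantsHypothesis.Theorems.FifoMatching.NNLinearDegreeCofactorHard.InflateWord

end
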